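import Literature.MathematicalPhysics.QuantumFieldTheory.Balaban1983to89.B6Ineq288MultiLevelBox
import Literature.MathematicalPhysics.QuantumFieldTheory.Balaban1983to89.B6Ineq2134OffDiag
import Literature.MathematicalPhysics.QuantumFieldTheory.Balaban1983to89.B6Eq291Generator

/-!
# `Balaban1983to89.B6Ineq2134ThetaKLevel` — T. Bałaban, *Propagators and renormalization transformations for lattice gauge theories. II*,
# Commun. Math. Phys. **96** (1984) 223–250 [Balaban1984PropagatorsII], p. 247: THE `O(M⁻¹)` OF (2.134) (`θ₀`-SMALLNESS) ON THE GENUINE `k`-LEVEL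
# FAMILY — the off-diagonal bound `|(K_{□,□′}G_{□′}h_{□′}J)(x)| ≤ O(M⁻¹)e^{−½δ₂d(y,y′)}|J|` with `∂P∂*` := THE GENUINE `k`-LEVEL OPERATOR OF (2.88)
# (its majorant, (2.60), (2.63) and the largeness of `M` DISCHARGED), `θ₀ = Θ·C_G/(m·M)` EXPLICIT, and the displayed threshold `N²θ₀c₁ < 1`

statement-level skeleton of published theorems with citation tags; proofs where landed; nothing here is a claim about the Yang–Mills mass gap

PDF held: `paper:balaban1984-cmp96-propagators-rt-ii` (journal page = PDF page + 222); p. 247 [PDF 25] and p. 239 [PDF 17] re-read AS IMAGES this session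
(`run/shared/lean/pub/pub-balaban/b2b-balaban-ref1/pages/1984-cmp96-propagators-rt-II/…-p025-x2.png`, `…-p017-x2.png`); p. 238 [PDF 16] ((2.88)) from the
tree transcriptions of `…B6Ineq288MultiLevelBox` / `…B6Ineq2134OffDiag`.  PRINT (p. 247, verbatim): *"We have |(G_□J)(x)|, |(∇G_□J)(x)| ≤
O(1)[(L^jη)², L^jη]e^{−δ₂(L^jη)^{−1}dist(Δ,Δ′)}|J|, (2.133) for x ∈ Δ(y), supp J ⊂ Δ(y′), y, y′ ∈ 𝔅 ∩ T_□. Applying the inequalities (2.133), (2.88)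
and the remarks after the inequality (2.68) we obtain |(K_{□,□′}G_{□′}h_{□′}J)(x)| ≤ O(M^{−1})e^{−½δ₂d(y,y′)}|J| (2.134) for x ∈ Δ(y), supp J ⊂ Δ(y′),
and this together with (2.91) implies |(RJ)(x)| ≤ O(M^{−1})e^{−½δ₂d(y,y′)}|J| … (2.135) Reasoning in the same way as in the proof of Proposition 2.2 we
obtain Proposition 2.6."*  p. 239: *"(K_{□,□′}A)_μ(x) = (h_□²(1 − ζ_□)∂P∂*h_{□′}A)_μ(x) (2.93) if □ ≠ □′. … The function ζ_□ is of the same type as h_□,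
but it is equal to 1 on a cube containing □ and with a boundary having the distance 1/3 M to the boundary of □, and it is equal to 0 outside a similar
cube with 1/3 M replaced by 2/3 M."* (the derivation of (2.91) forces the index `ζ_{□′}`: `…B6Eq291Generator` §1′, `kOff`).

CITATION HEADER (lean-in-tree rule) — WHAT IS REPRODUCED.  Phase-2 file of the `lit-balaban` typed skeleton (HOME `run/shared/lean/pub/lit-balaban/`), seat
**p38 gen 24**; owner-named target (B6 fold owner r03 gen 17, 2026-08-22T19:23Z / B6-CLOSURE v1.9f–g §5 item 6, «bite (b)»; bite (a) = (2.133) for the genuine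
two-scale `G_□`, `…B6Ineq2133TwoScaleV1`, p340300); SKELETON rows **B6.Eq2.134** × **B6.Eq2.88** × **B6.Prop2.6** (cells only; decls of record untouched).
The tree's `…B6Ineq2134OffDiag.offDiag_hasMajorant` (r03 gen 5) DERIVES (2.134) for □ ≠ □′ on an ABSTRACT geometry from five displayed inputs — the
(2.88)-shape majorant of `∂P∂*` (`hP`), the (2.133)-shape local majorant of `G_{□′}` (`hG`), (2.60) `LevelSep`, (2.63) at the rate `¾δ₂` (one intermediate
point), the largeness `L² ≤ e^{⅛δ₂RM}` — and `theta_le` turns its constant `θ = C_P·C_G·L²·c²·e^{−⅛δ₂mM}` into the printed `O(M⁻¹)`.  THIS FILE INSTANTIATES IT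
ON THE GENUINE `k`-LEVEL FAMILY of the tree — p21's nested Neumann-box members `i : KIdx d ℓ` with P7's census geometry `geoB i` (sites = the blocks `𝔅` of all
levels, `dist` = the multiscale distance (2.46), `L^jη` in print's units `η = L^{−k}`, the (2.60)-certified `R`, `M = L·M_h`) — DISCHARGING EVERY `k`-LEVEL INPUT:
* §1 the lattice of vector fields `XV i = Fin (d+1) × X` (component-wise, as P7's kernel `(∂P∂*)_{μν}(x, x′)` is indexed), the block map `blkV i (μ, x) = y(x)`,
  and **`DP i` := THE GENUINE `∂P∂*`** as an operator on `XV i → ℝ`: `(∂P∂*A)_μ(x) = Σ_{ν,x′} η^{d+1}(∂P∂*)_{μν}(x, x′)A_ν(x′)` with P7's print-unit kernel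
  `dPdP` (`P = G′Q′*(Q′G′²Q′*)⁻¹Q′G′` of (2.17), proved to be the paper's projection in `…B6Ineq288MultiLevelBox`);
* §2 **`hasMajorant_DP`**: `∃ M₃ δ_P C_P > 0 ∀ i, M₃ ≤ L·M_h → HasMajorant (blkV i) (DP i) (C_P·(L^jη)^{−2}·e^{−δ_P d(y,y″)})` — P7's pointwise
  `ineq288_kLevelP` BY NAME through r03's dictionary `hasMajorant_of_kernel288` (block volumes `#B(y″)η^{d+1} ≤ (L^{j″}η)^{d+1}` from p21's `card_blkOf_le`;
  the component sum costs the factor `d+1`);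
* §3 the walk inputs on `geoB i`: `levelSep_geoB` ((2.60), p21's `levelSepB`), `ineq263_geoB` ((2.63) at `(¾δ, ⅓)`, constant `K261 N₀ (d+1) L 1 (¼δ)`, for
  `L·M_h ≥ N₀ + 1`, p21's `lemma21_box`), `thr_geoB` (`L² ≤ e^{⅛δ·RM}` once `L·M_h ≥ N₂ + 1`);
* §4 **`ineq2134_offDiag_kLevel`** — (2.134) FOR □ ≠ □′ WITH THE GENUINE `∂P∂*`: for every rate `δ_G > 0` there are `M₀`, `δ ∈ (0, δ_G]`, `Θ ≥ 0` (on
  `d, L, δ_G`) such that for every member with `L·M_h ≥ M₀`, every `C_G ≥ 0`, `m > 0`, every operator `Gl` (`G_{□′}` transported to `XV i`) with the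
  (2.133)-shape local majorant `C_G·(L^jη)²·e^{−δ_G d}` on a reach set `S`, and partition data `a` (= `h_□²(1 − ζ_{□′})`), `h_{□′}` (`|a|, |h_{□′}| ≤ 1`, `a = 0`
  on the blocks of the core `Score`, `supp h_{□′}` within the blocks of `S`, gap `m·M ≤ d(y, y″)` for `y ∉ Score`, `y″ ∈ S`):
  `HasMajorant (blkV i) (a·∂P∂*·(h_{□′}G_{□′}h_{□′})) (θ₀·e^{−½δ d(y,y′)})` with **`θ₀ = Θ·C_G/(m·M)`** — the printed `O(M⁻¹)`, every factor located;
  **`ineq2134_kOff_kLevel`**: the same for `(K_{□,□′}G_{□′})·h_{□′}`, `K_{□,□′} = …B6Eq291Generator.kOff (∂P∂*) h_□ ζ_{□′} h_{□′}` BY NAME, from `|h_□| ≤ 1`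
  ((2.36)), `0 ≤ ζ_{□′} ≤ 1`, `ζ_{□′} = 1` on the blocks of `Score` — literally the hypothesis `h2134` of `…B6Prop26Gluing.majorant_R_of_2134` /
  `prop26_2136_of_2133_2134(_lemma21)` for the pair (□, □′) (`Kt □ □′ = K_{□,□′}G_{□′}`, rate written `δ/2·d`);
* §5 **THE DISPLAYED THRESHOLD** (cell SMALLNESS S-B6.3): `theta0_lt` (`N²·θ₀·c₁ < ε` for `M ≥ M₁ = N²ΘC_Gc₁/(mε) + 1`), `ineq2134_kOff_kLevel_small` (the
  majorant AND the located smallness `N²θ₀c₁ < 1` = `hsmall` of `prop26_2136_of_2133_2134`, above ONE threshold); non-vacuity of every threshold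
  (members with `k ≥ 2` genuine levels) is P7's `…B6Ineq288MultiLevelBox.ineq288_kLevelP_nonvacuous`, not restated.
IMPORTS BY NAME, restating nothing; four `def`s with bodies (`XV`, `blkV`, `DPmat`, `DP`); NO `def … : Prop`, no new hypothesis-fact; standard axioms.
HONEST SCOPE / DIVERGENCES. (1) The `G_{□′}`-side of (2.134) is NOT discharged here: it is the (2.133)-shape hypothesis `hG` on `geoB i` — its discharge is
bite (a) (`…B6Ineq2133TwoScaleV1`: majorant `A·e^{−δ₂|y−y′|_T}` on the torus blocks `T^{(j)}` of one two-scale step) COMPOSED WITH the owner's geometry bridge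
(B6-CLOSURE §5 item 6 (c): identification of the `T^{(j)}`-blocks in the reach `□̃′` with sites of `geoB i`, transport of `G_{□′}` from `T_{□′}` to `XV i`; a
torus-distance majorant becomes a `d`-majorant where `d ≤ κ·|y − y′|_T` on the reach — cell GAPS G-pv08-1 / G-pv01-5 (i)); nothing about that bridge is
claimed. (2) The partition data (`h_□`, `ζ_□`, reach sets, the printed gap *"1/3 M"* as `m·M` in the distance `d`) are hypotheses in the exact shape of
`offDiag_hasMajorant` (the cover is p21's `…B6Cover236MultiLevelBlocks`, not imported). (3) The DIAGONAL pairs `K_{□,□}` ((2.92); r03's `…B6Ineq2134Diag`) are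
not treated. (4) Setting of the `k`-level family as in P7: levels `1 … k` on a Neumann box, `m² = 0`, `L ≥ 2`, print's units `η = L^{−k}`; constants
existential (on `d, L, δ_G`); the rate bookkeeping (`δ = min(δ_P, δ_G)`, ⅛, ¾, ⅓) is ours — *"The choice of factors is again arbitrary"* (p. 238).
Nothing on d = 4 or the continuum; NOT summit progress.  Unit `lit-balaban-p38` (gen 24), 2026-08-22.
-/

noncomputable section

namespace Literature.MathematicalPhysics.QuantumFieldTheory.Balaban1983to89.B6Ineq2134ThetaKLevel

open B6Geom246MultiLevelBox (blkOf lemma21_box)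
open B6Ineq268MultiLevelBox (W W_eq card_blkOf_le levelSepB)
open B6Prop22KLevelCensus (KIdx)
open B6Prop22KLevelCensusEta (nK nK_pos geoP len_pos)
open B6Ineq288MultiLevelBox (geoB geoB_M geoB_L geoB_eta geoB_len geoB_RM dist_nonneg_geoB dPdP ineq288_kLevelP)
open B6Ineq261LevelGap (K261 theta_lt_one_of_log)
open B6RandomWalk (HasMajorant hasMajorant_mono)
open B6Prop26Gluing (mulOp mulOp_apply LocalMajorant)
open B6Ineq268 (LevelSep)
open B6Lemma21Repaired (Ineq263With)
open B6Ineq2134OffDiag (offDiag_hasMajorant theta_le hasMajorant_of_kernel288)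
open B6Eq291Generator (kOff)

variable {d ℓ : ℕ}

/-! ## §1  The lattice of vector fields of a member and the genuine `∂P∂*` -/

/-- **THE LATTICE OF VECTOR FIELDS** of the member: pairs (component `μ`, site `x` of the fine box) — the index set of P7's kernel `(∂P∂*)_{μν}(x, x′)`.
[cite: Balaban1984PropagatorsII, (2.88) p.238 («(∂P∂*)_{μν}(x, x′)»), dictionary] -/
abbrev XV (i : KIdx d ℓ) : Type := Fin (d + 1) × ↥(i.XB)

/-- the block map of the vector-field lattice: `(μ, x) ↦ y(x) ∈ 𝔅` (*"x ∈ B^j(y)"*). [cite: Balaban1984PropagatorsII, (2.88) p.238, (2.46) p.231, dictionary] -/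
abbrev blkV (i : KIdx d ℓ) : XV i → (geoB i).Site := fun q => blkOf i.D q.2

/-- the matrix of the genuine `∂P∂*` on vector fields in print's units: `η^{d+1}·(∂P∂*)_{μν}(x, x′)` (the `η^{d+1}`-pairing of P7's kernel `dPdP`).
[cite: Balaban1984PropagatorsII, (2.88) p.238, (2.17)–(2.18) p.225, dictionary] -/
def DPmat (i : KIdx d ℓ) : Matrix (XV i) (XV i) ℝ :=
  fun p q => ((((nK i : ℕ) : ℝ))⁻¹) ^ (d + 1) * dPdP i p.1 q.1 p.2 q.2

/-- **`∂P∂*` OF (2.88)/(2.93) AS AN OPERATOR ON VECTOR FIELDS** (`P = G′Q′*(Q′G′²Q′*)⁻¹Q′G′` of (2.17), P7's `pM`, print's units):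
`(∂P∂*A)_μ(x) = Σ_{ν,x′} η^{d+1}(∂P∂*)_{μν}(x, x′)A_ν(x′)`. [cite: Balaban1984PropagatorsII, (2.88) p.238, (2.93) p.239] -/
def DP (i : KIdx d ℓ) : Module.End ℝ (XV i → ℝ) := Matrix.toLin' (DPmat i)

/-- `∂P∂*` evaluated. [cite: Balaban1984PropagatorsII, (2.88) p.238, dictionary] -/
theorem DP_apply (i : KIdx d ℓ) (A : XV i → ℝ) (p : XV i) :
    DP i A p = ∑ q : XV i, ((((nK i : ℕ) : ℝ))⁻¹) ^ (d + 1) * dPdP i p.1 q.1 p.2 q.2 * A q := by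
  simp only [DP, Matrix.toLin'_apply, Matrix.mulVec, dotProduct, DPmat]

/-! ## §2  The (2.88)-shape block majorant of the genuine `∂P∂*` -/

/-- block volumes in the vector-field lattice: a set of pairs `(ν, x′)` over ONE block `y′` has at most `(d+1)·#B(y′) ≤ (d+1)(L^{j′})^{d+1}` elements
(p21's `card_blkOf_le`), i.e. `#·η^{d+1}/(d+1) ≤ (L^{j′}η)^{d+1}`. [cite: Balaban1984PropagatorsII, (2.1) p.224, (2.69) p.235, dictionary] -/
private theorem card_blkV_mul_le (i : KIdx d ℓ) (y' : (geoB i).Site) (s : Finset (XV i)) (hs : ∀ q ∈ s, blkV i q = y') :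
    (s.card : ℝ) * (((((nK i : ℕ) : ℝ))⁻¹) ^ (d + 1) / ((d : ℝ) + 1)) ≤ (geoB i).len y' ^ (d + 1) := by
  classical
  have hd1 : (0 : ℝ) < (d : ℝ) + 1 := by positivity
  have hsub : s ⊆ (Finset.univ : Finset (Fin (d + 1))) ×ˢ (Finset.univ.filter fun x : ↥(i.XB) => blkOf i.D x = y') := fun q hq =>
    Finset.mem_product.2 ⟨Finset.mem_univ _, Finset.mem_filter.2 ⟨Finset.mem_univ _, hs q hq⟩⟩
  have hcard : (s.card : ℝ) ≤ ((d : ℝ) + 1) * W i.D y' := by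
    have h1 := Finset.card_le_card hsub
    rw [Finset.card_product, Finset.card_univ, Fintype.card_fin] at h1
    have h2 : (s.card : ℝ) ≤ ((d + 1 : ℕ) : ℝ) *
        (((Finset.univ.filter fun x : ↥(i.XB) => blkOf i.D x = y').card : ℕ) : ℝ) := by exact_mod_cast h1
    push_cast at h2
    exact h2.trans (mul_le_mul_of_nonneg_left (card_blkOf_le i.D y') hd1.le)
  rw [geoB_len, W_eq] at *
  calc (s.card : ℝ) * (((((nK i : ℕ) : ℝ))⁻¹) ^ (d + 1) / ((d : ℝ) + 1))
      ≤ ((d : ℝ) + 1) * (((ℓ : ℝ) + 1) ^ y'.1.1) ^ (d + 1) * (((((nK i : ℕ) : ℝ))⁻¹) ^ (d + 1) / ((d : ℝ) + 1)) :=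
        mul_le_mul_of_nonneg_right hcard (by positivity)
    _ = (((ℓ : ℝ) + 1) ^ y'.1.1 * (((nK i : ℕ) : ℝ))⁻¹) ^ (d + 1) := by rw [mul_pow]; field_simp

/-- **THE (2.88)-SHAPE BLOCK MAJORANT OF THE GENUINE `k`-LEVEL `∂P∂*`**: `∃ M₃ δ_P C_P > 0 ∀ i, M₃ ≤ L·M_h →
|(∂P∂*μ)_ν(x)| ≤ C_P·(L^jη)^{−2}·e^{−δ_P d(y(x), y″)}·B` whenever `supp μ ⊂ B(y″)` (all components), `|μ| ≤ B` — the hypothesis `hP` of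
`…B6Ineq2134OffDiag.offDiag_hasMajorant`, from P7's printed pointwise (2.88) `ineq288_kLevelP` BY NAME through `hasMajorant_of_kernel288` (block volume
`(L^{j″}η)^{−(d+1)}` against `#B(y″)η^{d+1}`; the component sum absorbed in `C_P`). [cite: Balaban1984PropagatorsII, (2.88) p.238; (2.68) p.235 (remarks)] -/
theorem hasMajorant_DP (d ℓ : ℕ) (hℓ : 1 ≤ ℓ) :
    ∃ M₃ δP CP : ℝ, 0 < M₃ ∧ 0 < δP ∧ 0 < CP ∧ ∀ i : KIdx d ℓ, M₃ ≤ ((ℓ : ℝ) + 1) * i.Mh →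
      HasMajorant (g := geoB i) (blkV i) (DP i) (fun y y'' => CP / (geoB i).len y ^ 2 * Real.exp (-(δP * (geoB i).dist y y''))) := by
  obtain ⟨M₃, δP, C, hM₃, hδP, hC, h288⟩ := ineq288_kLevelP d ℓ hℓ
  have hd1 : (0 : ℝ) < (d : ℝ) + 1 := by positivity
  refine ⟨M₃, δP, ((d : ℝ) + 1) * C, hM₃, hδP, mul_pos hd1 hC, fun i hM => ?_⟩
  have hL0 : (0 : ℝ) < (geoB i).L := by rw [geoB_L]; positivity
  have hη : 0 < (geoB i).eta := by rw [geoB_eta]; exact inv_pos.2 (nK_pos i)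
  refine hasMajorant_of_kernel288 (g := geoB i) (blkV i) hL0 hη (d + 1) (DP i) (fun p q => ((d : ℝ) + 1) * dPdP i p.1 q.1 p.2 q.2)
    (w := ((((nK i : ℕ) : ℝ))⁻¹) ^ (d + 1) / ((d : ℝ) + 1)) (by positivity) (mul_pos hd1 hC).le ?_ ?_ ?_
  · -- the operator in the `η^{d+1}`-pairing form
    intro A p
    rw [DP_apply]
    refine Finset.sum_congr rfl fun q _ => ?_
    field_simp
  · -- block volumes
    classical
    intro y'
    exact card_blkV_mul_le i y' _ fun q hq => (Finset.mem_filter.1 hq).2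
  · -- the printed pointwise (2.88)
    intro p q
    have h := h288 i hM p.1 q.1 p.2 q.2
    have hly : (geoB i).len (blkV i p) = (geoP i).len (blkOf i.D p.2) := rfl
    have hly' : (geoB i).len (blkV i q) = (geoP i).len (blkOf i.D q.2) := rfl
    have hdi : (geoB i).dist (blkV i p) (blkV i q) = (B6Geom246MultiLevelBox.geom i.D).dist (blkOf i.D p.2) (blkOf i.D q.2) := rfl
    rw [hly, hly', hdi, abs_mul, abs_of_pos hd1]
    have h1 : (geoP i).len (blkOf i.D p.2) ^ (-(2 : ℝ)) = ((geoP i).len (blkOf i.D p.2) ^ 2)⁻¹ := by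
      rw [Real.rpow_neg (len_pos i _).le, Real.rpow_two]
    have h2 : (geoP i).len (blkOf i.D q.2) ^ (-((d + 1 : ℕ) : ℝ)) = ((geoP i).len (blkOf i.D q.2) ^ (d + 1))⁻¹ := by
      rw [Real.rpow_neg (len_pos i _).le, Real.rpow_natCast]
    rw [h1, h2] at h
    calc ((d : ℝ) + 1) * |dPdP i p.1 q.1 p.2 q.2|
        ≤ ((d : ℝ) + 1) * (C * ((geoP i).len (blkOf i.D p.2) ^ 2)⁻¹ * ((geoP i).len (blkOf i.D q.2) ^ (d + 1))⁻¹ *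
            Real.exp (-(δP * (B6Geom246MultiLevelBox.geom i.D).dist (blkOf i.D p.2) (blkOf i.D q.2)))) := mul_le_mul_of_nonneg_left h hd1.le
      _ = _ := by rw [div_eq_mul_inv, div_eq_mul_inv]; ring

/-! ## §3  The walk inputs on `geoB`: (2.60), (2.63) at `(¾δ, ⅓)`, and the largeness `L² ≤ e^{⅛δRM}` -/

/-- `1 ≤ R·L·M_h` for every member (`R ≥ 2L`, `M_h ≥ 1`). [cite: Balaban1984PropagatorsII, (2.2) p.224, bookkeeping] -/
private theorem one_le_RLMh (i : KIdx d ℓ) : 1 ≤ i.R * ((ℓ + 1) * i.Mh) :=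
  Nat.one_le_iff_ne_zero.2 (Nat.mul_ne_zero_iff.2 ⟨by have := i.hR; omega, Nat.mul_ne_zero_iff.2 ⟨by omega, by have := i.hMh; omega⟩⟩)

/-- a real threshold on `L·M_h` gives the walk threshold `N + 1 ≤ R·L·M_h` (P7's bookkeeping). [cite: Balaban1984PropagatorsII, (2.2) p.224, (2.59) p.233, bookkeeping] -/
private theorem walk_threshold (i : KIdx d ℓ) (N : ℕ) (hN : (N : ℝ) + 1 ≤ ((ℓ : ℝ) + 1) * i.Mh) : N + 1 ≤ i.R * ((ℓ + 1) * i.Mh) := by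
  have hR1 : 1 ≤ i.R := le_trans (by omega) i.hR
  have h1 : ((N + 1 : ℕ) : ℝ) ≤ (((ℓ + 1) * i.Mh : ℕ) : ℝ) := by push_cast; exact hN
  have h2 : N + 1 ≤ (ℓ + 1) * i.Mh := by exact_mod_cast h1
  exact h2.trans (Nat.le_mul_of_pos_left _ hR1)

/-- **(2.60) `LevelSep` FOR `geoB`** (`RM·max{|j−j′|−1, 0} ≤ d(y,y′)` with the certified `R`; p21's `levelSepB`). [cite: Balaban1984PropagatorsII, Lemma 2.1 (2.60) p.234] -/
theorem levelSep_geoB (i : KIdx d ℓ) : LevelSep (geoB i) :=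
  levelSepB i.D i.hMh i.hP (one_le_RLMh i)

/-- **(2.63) AT THE RATE `¾δ` WITH `α = ⅓` ON `geoB`** — the `y″`-sum input `h263` of `offDiag_hasMajorant` — from p21's `lemma21_box` with the constant
`c = K261 N₀ (d+1) L 1 (¼δ)` for every member with `L·M_h ≥ N₀ + 1` (`N₀ = ⌈8(d+1)L/δ⌉ + 1` makes the (2.59)-shape ratio `e^{−¼δ}L^{2(d+1)/N₀} < 1`).
[cite: Balaban1984PropagatorsII, Lemma 2.1 (2.63) p.234, (2.59) p.233] -/
theorem ineq263_geoB (d ℓ : ℕ) {δ : ℝ} (hδ : 0 < δ) :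
    ∃ N₀ : ℕ, 0 < N₀ ∧ ∀ i : KIdx d ℓ, (N₀ : ℝ) + 1 ≤ ((ℓ : ℝ) + 1) * i.Mh →
      Ineq263With (K261 N₀ (d + 1) ((ℓ : ℝ) + 1) 1 (1 / 3 * (3 / 4 * δ))) (geoB i) (3 / 4 * δ) (1 / 3) := by
  have hL0 : (0 : ℝ) < (ℓ : ℝ) + 1 := by positivity
  have hlog : Real.log ((ℓ : ℝ) + 1) ≤ (ℓ : ℝ) + 1 := (Real.log_le_sub_one_of_pos hL0).trans (by linarith)
  obtain ⟨N₀, hN₀⟩ : ∃ N₀ : ℕ, N₀ = ⌈8 * ((d : ℝ) + 1) * ((ℓ : ℝ) + 1) / δ⌉₊ + 1 := ⟨_, rfl⟩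
  have hN₀pos : 0 < N₀ := by rw [hN₀]; omega
  have hN₀ge : 8 * ((d : ℝ) + 1) * ((ℓ : ℝ) + 1) < δ * (N₀ : ℝ) := by
    have h : 8 * ((d : ℝ) + 1) * ((ℓ : ℝ) + 1) / δ < (N₀ : ℝ) := by
      rw [hN₀]; push_cast; exact lt_of_le_of_lt (Nat.le_ceil _) (by linarith)
    rw [div_lt_iff₀ hδ] at h; linarith
  have hθ : Real.exp (-(1 / 3 * (3 / 4 * δ))) * ((ℓ : ℝ) + 1) ^ ((2 * (d + 1 : ℕ) : ℝ) / N₀) < 1 := by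
    refine theta_lt_one_of_log hL0 hN₀pos ?_
    push_cast
    have h1 := mul_le_mul_of_nonneg_left hlog (by positivity : (0 : ℝ) ≤ 2 * ((d : ℝ) + 1))
    linarith
  refine ⟨N₀, hN₀pos, fun i hM => ?_⟩
  obtain ⟨-, -, -, h263⟩ := lemma21_box i.D i.hMh i.hP hN₀pos (walk_threshold i N₀ hM) (δ₀ := 3 / 4 * δ) (α := 1 / 3)
    (by positivity) (by norm_num) (by norm_num) hθ
  exact fun m y y' => h263 m y y'

/-- **THE LARGENESS `L² ≤ e^{⅛δ·RM}`** (threshold of the power trading *"the remarks after (2.68)"*, hypothesis `hthr` of `offDiag_hasMajorant`) for every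
member with `L·M_h ≥ N₂ + 1`, `N₂ = ⌈16L/δ⌉` (`RM = R·L·M_h − 1 ≥ N₂`). [cite: Balaban1984PropagatorsII, (2.68) p.235 (remarks), (2.59) p.233] -/
theorem thr_geoB (d ℓ : ℕ) {δ : ℝ} (hδ : 0 < δ) :
    ∃ N₂ : ℕ, ∀ i : KIdx d ℓ, (N₂ : ℝ) + 1 ≤ ((ℓ : ℝ) + 1) * i.Mh → (geoB i).L ^ 2 ≤ Real.exp (1 / 8 * δ * ((geoB i).R * (geoB i).M)) := by
  have hL0 : (0 : ℝ) < (ℓ : ℝ) + 1 := by positivity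
  have hlog : Real.log ((ℓ : ℝ) + 1) ≤ (ℓ : ℝ) + 1 := (Real.log_le_sub_one_of_pos hL0).trans (by linarith)
  obtain ⟨N₂, hN₂⟩ : ∃ N₂ : ℕ, N₂ = ⌈16 * ((ℓ : ℝ) + 1) / δ⌉₊ := ⟨_, rfl⟩
  have hN₂ge : 16 * ((ℓ : ℝ) + 1) ≤ δ * (N₂ : ℝ) := by
    have h : 16 * ((ℓ : ℝ) + 1) / δ ≤ (N₂ : ℝ) := by rw [hN₂]; exact Nat.le_ceil _
    rw [div_le_iff₀ hδ] at h; linarith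
  refine ⟨N₂, fun i hM => ?_⟩
  have hR1 : (1 : ℝ) ≤ (i.R : ℝ) := by
    have : (1 : ℕ) ≤ i.R := by have := i.hR; omega
    exact_mod_cast this
  have hMh0 : (0 : ℝ) ≤ ((ℓ : ℝ) + 1) * i.Mh := by positivity
  have hge : (N₂ : ℝ) ≤ (geoB i).R * (geoB i).M := by
    rw [geoB_RM]
    have : ((ℓ : ℝ) + 1) * i.Mh ≤ (i.R : ℝ) * (((ℓ : ℝ) + 1) * i.Mh) := by nlinarith
    linarith
  have hE : 2 * Real.log ((ℓ : ℝ) + 1) ≤ 1 / 8 * δ * ((geoB i).R * (geoB i).M) := by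
    have h3 := mul_le_mul_of_nonneg_left hge (by positivity : (0 : ℝ) ≤ 1 / 8 * δ)
    nlinarith
  rw [geoB_L]
  calc ((ℓ : ℝ) + 1) ^ 2 = Real.exp (Real.log (((ℓ : ℝ) + 1) ^ 2)) := (Real.exp_log (by positivity)).symm
    _ = Real.exp (2 * Real.log ((ℓ : ℝ) + 1)) := by rw [Real.log_pow]; norm_num
    _ ≤ _ := Real.exp_le_exp.2 hE

/-! ## §4  (2.134) for □ ≠ □′ with the genuine `k`-level `∂P∂*`, `θ₀` explicit -/

/-- monotonicity of a local majorant in the kernel. [folklore] -/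
private theorem localMajorant_mono {g : B6.Geometry} {X : Type} (blk : X → g.Site) {T : Module.End ℝ (X → ℝ)} {S : Set g.Site}
    {K K' : g.Site → g.Site → ℝ} (h : LocalMajorant blk T S K) (hle : ∀ a b, K a b ≤ K' a b) : LocalMajorant blk T S K' :=
  fun y' hy' μ B hμ x hx => (h y' hy' μ B hμ x hx).trans (mul_le_mul_of_nonneg_right (hle _ _) hμ.nonneg)

/-- lowering the rate of an exponential majorant on non-negative distances. [folklore] -/
private theorem expKernel_mono {c δ δ' t : ℝ} (hc : 0 ≤ c) (hδ : δ' ≤ δ) (ht : 0 ≤ t) :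
    c * Real.exp (-(δ * t)) ≤ c * Real.exp (-(δ' * t)) :=
  mul_le_mul_of_nonneg_left (Real.exp_le_exp.2 (neg_le_neg (mul_le_mul_of_nonneg_right hδ ht))) hc

/-- **(2.134) FOR THE OFF-DIAGONAL PAIRS □ ≠ □′ WITH THE GENUINE `k`-LEVEL `∂P∂*`, THE `O(M⁻¹)` EXPLICIT.**  For every rate `δ_G > 0` there are a threshold
`M₀`, a rate `δ ∈ (0, δ_G]` and a constant `Θ ≥ 0` (on `d, L, δ_G` only) such that for every member `i` with `L·M_h ≥ M₀`, every `C_G ≥ 0`, `m > 0`, every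
operator `Gl` (`G_{□′}` transported to the vector fields of the box) with the (2.133)-shape local majorant `C_G·(L^jη)²·e^{−δ_G d(y″,y′)}` on a reach set `S`,
and partition data `a` (= `h_□²(1 − ζ_{□′})`: `|a| ≤ 1`, vanishing on the blocks of the core `Score`), `hI` (= `h_{□′}`: `|hI| ≤ 1`, supported within the
blocks of `S`) with the gap `m·M ≤ d(y, y″)` for `y ∉ Score`, `y″ ∈ S` (*"distance 1/3 M"*): `|(a·∂P∂*·h_{□′}G_{□′}h_{□′}J)_μ(x)| ≤ θ₀·e^{−½δ d(y,y′)}·|J|`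
for `x ∈ B(y)`, `supp J ⊂ B(y′)`, with **`θ₀ = Θ·C_G/(m·M)`**, `M = L·M_h` — r03's `offDiag_hasMajorant` + `theta_le` with `hP` := §2 and (2.60), (2.63),
`L² ≤ e^{⅛δRM}` := §3. [cite: Balaban1984PropagatorsII, (2.134) p.247; (2.88) p.238; (2.93) p.239; Lemma 2.1 p.234] -/
theorem ineq2134_offDiag_kLevel (d ℓ : ℕ) (hℓ : 1 ≤ ℓ) {δG : ℝ} (hδG : 0 < δG) :
    ∃ M₀ δ Θ : ℝ, 0 < M₀ ∧ 0 < δ ∧ δ ≤ δG ∧ 0 ≤ Θ ∧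
      ∀ i : KIdx d ℓ, M₀ ≤ ((ℓ : ℝ) + 1) * i.Mh → ∀ {CG m : ℝ}, 0 ≤ CG → 0 < m →
        ∀ {Gl : Module.End ℝ (XV i → ℝ)} {a hI : XV i → ℝ} {S Score : Set (geoB i).Site},
          LocalMajorant (blkV i) Gl S (fun y'' y' => CG * (geoB i).len y'' ^ 2 * Real.exp (-(δG * (geoB i).dist y'' y'))) →
          (∀ x, |a x| ≤ 1) → (∀ x, a x ≠ 0 → blkV i x ∉ Score) → (∀ x, |hI x| ≤ 1) → (∀ x, hI x ≠ 0 → blkV i x ∈ S) →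
          (∀ y y'', y ∉ Score → y'' ∈ S → m * (geoB i).M ≤ (geoB i).dist y y'') →
          HasMajorant (blkV i) (mulOp a * DP i * (mulOp hI * Gl * mulOp hI))
            (fun y y' => Θ * CG / m * ((geoB i).M)⁻¹ * Real.exp (-(1 / 2 * δ * (geoB i).dist y y'))) := by
  -- the genuine `∂P∂*` and its (2.88) majorant; the common rate `δ = min(δ_P, δ_G)`
  obtain ⟨M₃, δP, CP, hM₃, hδP, hCP, hDP⟩ := hasMajorant_DP d ℓ hℓ
  obtain ⟨δ, hδdef⟩ : ∃ δ : ℝ, δ = min δP δG := ⟨_, rfl⟩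
  have hδ : 0 < δ := by rw [hδdef]; exact lt_min hδP hδG
  have hδP' : δ ≤ δP := by rw [hδdef]; exact min_le_left _ _
  have hδG' : δ ≤ δG := by rw [hδdef]; exact min_le_right _ _
  -- (2.63) at `(¾δ, ⅓)`, the largeness threshold, the constants
  obtain ⟨N₀, hN₀pos, h263⟩ := ineq263_geoB d ℓ hδ
  obtain ⟨N₂, hthr⟩ := thr_geoB d ℓ hδ
  obtain ⟨c, hc⟩ : ∃ c : ℝ, c = K261 N₀ (d + 1) ((ℓ : ℝ) + 1) 1 (1 / 3 * (3 / 4 * δ)) := ⟨_, rfl⟩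
  obtain ⟨M₀, hM₀⟩ : ∃ M₀ : ℝ, M₀ = max M₃ (max ((N₀ : ℝ) + 1) ((N₂ : ℝ) + 1)) := ⟨_, rfl⟩
  obtain ⟨Θ, hΘ⟩ : ∃ Θ : ℝ, Θ = 8 * CP * ((ℓ : ℝ) + 1) ^ 2 * c ^ 2 / δ := ⟨_, rfl⟩
  have hΘnn : 0 ≤ Θ := by rw [hΘ]; have := hCP.le; positivity
  refine ⟨M₀, δ, Θ, by rw [hM₀]; exact lt_max_of_lt_left hM₃, hδ, hδG', hΘnn, ?_⟩
  intro i hM CG m hCG hm Gl a hI S Score hG ha1 haS hI1 hIS hgap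
  -- the member's thresholds and side facts
  have hM3 : M₃ ≤ ((ℓ : ℝ) + 1) * i.Mh := (le_max_left _ _).trans (hM₀ ▸ hM)
  have hMN₀ : (N₀ : ℝ) + 1 ≤ ((ℓ : ℝ) + 1) * i.Mh := ((le_max_left _ _).trans (le_max_right _ _)).trans (hM₀ ▸ hM)
  have hMN₂ : (N₂ : ℝ) + 1 ≤ ((ℓ : ℝ) + 1) * i.Mh := ((le_max_right _ _).trans (le_max_right _ _)).trans (hM₀ ▸ hM)
  have hL1 : (1 : ℝ) ≤ (geoB i).L := by rw [geoB_L]; linarith [(Nat.cast_nonneg ℓ : (0 : ℝ) ≤ ℓ)]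
  have hη : 0 < (geoB i).eta := by rw [geoB_eta]; exact inv_pos.2 (nK_pos i)
  have hMpos : 0 < (geoB i).M := by
    rw [geoB_M]
    have h1 : (1 : ℝ) ≤ (i.Mh : ℝ) := by exact_mod_cast i.hMh
    have h2 : (0 : ℝ) < (ℓ : ℝ) + 1 := by positivity
    nlinarith
  have hRM : 0 ≤ (geoB i).R * (geoB i).M := by
    rw [geoB_RM]
    have : ((1 : ℕ) : ℝ) ≤ ((i.R * ((ℓ + 1) * i.Mh) : ℕ) : ℝ) := by exact_mod_cast one_le_RLMh i
    push_cast at this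
    linarith
  -- the inputs of `offDiag_hasMajorant`, at the common rate `δ`
  have hP : HasMajorant (g := geoB i) (blkV i) (DP i) (fun y y'' => CP / (geoB i).len y ^ 2 * Real.exp (-(δ * (geoB i).dist y y''))) :=
    hasMajorant_mono _ (hDP i hM3) fun y y'' => expKernel_mono (div_nonneg hCP.le (sq_nonneg _)) hδP' (dist_nonneg_geoB i y y'')
  have hG' : LocalMajorant (blkV i) Gl S (fun y'' y' => CG * (geoB i).len y'' ^ 2 * Real.exp (-(δ * (geoB i).dist y'' y'))) :=
    localMajorant_mono _ hG fun y'' y' => expKernel_mono (mul_nonneg hCG (sq_nonneg _)) hδG' (dist_nonneg_geoB i y'' y')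
  have h263i : Ineq263With c (geoB i) (3 / 4 * δ) (1 / 3) := by rw [hc]; exact h263 i hMN₀
  have key := offDiag_hasMajorant (blkV i) hL1 hη (levelSep_geoB i) (dist_nonneg_geoB i) hδ.le hCP.le hCG hRM (hthr i hMN₂) h263i hP hG'
    ha1 haS hI1 hIS hgap
  -- `θ = C_P·C_G·L²·c²·e^{−⅛δ mM} ≤ Θ·C_G/(m·M)` (r03's `theta_le`)
  refine hasMajorant_mono _ key fun y y' => ?_
  have hθ := theta_le (L := (geoB i).L) (c := c) hδ hm hMpos hCP.le hCG
  have hid : 8 * CP * CG * (geoB i).L ^ 2 * c ^ 2 / (δ * m) = Θ * CG / m := by rw [hΘ, geoB_L]; field_simp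
  rw [hid] at hθ
  exact mul_le_mul_of_nonneg_right hθ (Real.exp_nonneg _)

/-- algebra of multiplication operators: `h_□·h_□·(1 − ζ_{□′}) = (h_□²(1 − ζ_{□′}))·` as operators. [folklore] -/
private theorem mulOp_mul_mulOp_one_sub {X : Type} (h z : X → ℝ) : mulOp h * mulOp h * (1 - mulOp z) = mulOp (fun x => h x * h x * (1 - z x)) := by
  refine LinearMap.ext fun v => funext fun x => ?_
  simp only [Module.End.mul_apply, LinearMap.sub_apply, Module.End.one_apply, Pi.sub_apply, mulOp_apply]
  ring

/-- `|h| ≤ 1`, `0 ≤ ζ ≤ 1` give `|h²(1 − ζ)| ≤ 1`. [cite: Balaban1984PropagatorsII, (2.36) p.229, (2.93) p.239, bookkeeping] -/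
private theorem abs_sq_one_sub_le {h z : ℝ} (hh : |h| ≤ 1) (hz0 : 0 ≤ z) (hz1 : z ≤ 1) : |h * h * (1 - z)| ≤ 1 := by
  rw [abs_mul, abs_mul, abs_of_nonneg (by linarith : (0 : ℝ) ≤ 1 - z)]
  nlinarith [abs_nonneg h, mul_nonneg (abs_nonneg h) (abs_nonneg h)]

/-- **(2.134) FOR `K_{□,□′}G_{□′}h_{□′}` WITH `K_{□,□′} = h_□²(1 − ζ_{□′})∂P∂*h_{□′}` OF (2.93) BY NAME** (`…B6Eq291Generator.kOff`, the index `ζ_{□′}` forced by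
the derivation of (2.91)), `∂P∂*` the genuine `k`-level operator: under `|h_□| ≤ 1` ((2.36)), `0 ≤ ζ_{□′} ≤ 1` with `ζ_{□′} = 1` on the blocks of the core
`Score`, `|h_{□′}| ≤ 1` supported within the blocks of `S`, the gap `m·M` and the (2.133)-shape local majorant of `G_{□′}` — for all members above ONE threshold:
`HasMajorant (blkV i) ((K_{□,□′}·G_{□′})·h_{□′}) (θ₀·e^{−(δ/2)d(y,y′)})`, `θ₀ = Θ·C_G/(m·M)` — LITERALLY the hypothesis `h2134` of
`…B6Prop26Gluing.majorant_R_of_2134` / `prop26_2136_of_2133_2134` for the pair (□, □′) (`Kt □ □′ = K_{□,□′}G_{□′}`).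
[cite: Balaban1984PropagatorsII, (2.134) p.247; (2.93) p.239; (2.36) p.229] -/
theorem ineq2134_kOff_kLevel (d ℓ : ℕ) (hℓ : 1 ≤ ℓ) {δG : ℝ} (hδG : 0 < δG) :
    ∃ M₀ δ Θ : ℝ, 0 < M₀ ∧ 0 < δ ∧ δ ≤ δG ∧ 0 ≤ Θ ∧
      ∀ i : KIdx d ℓ, M₀ ≤ ((ℓ : ℝ) + 1) * i.Mh → ∀ {CG m : ℝ}, 0 ≤ CG → 0 < m →
        ∀ {Gl : Module.End ℝ (XV i → ℝ)} {h z h' : XV i → ℝ} {S Score : Set (geoB i).Site},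
          LocalMajorant (blkV i) Gl S (fun y'' y' => CG * (geoB i).len y'' ^ 2 * Real.exp (-(δG * (geoB i).dist y'' y'))) →
          (∀ x, |h x| ≤ 1) → (∀ x, 0 ≤ z x) → (∀ x, z x ≤ 1) → (∀ x, z x ≠ 1 → blkV i x ∉ Score) →
          (∀ x, |h' x| ≤ 1) → (∀ x, h' x ≠ 0 → blkV i x ∈ S) →
          (∀ y y'', y ∉ Score → y'' ∈ S → m * (geoB i).M ≤ (geoB i).dist y y'') →
          HasMajorant (blkV i) ((kOff (DP i) (mulOp h) (mulOp z) (mulOp h') * Gl) * mulOp h')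
            (fun y y' => Θ * CG / m * ((geoB i).M)⁻¹ * Real.exp (-(δ / 2 * (geoB i).dist y y'))) := by
  obtain ⟨M₀, δ, Θ, hM₀, hδ, hδG', hΘ, hall⟩ := ineq2134_offDiag_kLevel d ℓ hℓ hδG
  refine ⟨M₀, δ, Θ, hM₀, hδ, hδG', hΘ, ?_⟩
  intro i hM CG m hCG hm Gl h z h' S Score hG hh hz0 hz1 hzS hh' hh'S hgap
  have ha1 : ∀ x, |h x * h x * (1 - z x)| ≤ 1 := fun x => abs_sq_one_sub_le (hh x) (hz0 x) (hz1 x)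
  have haS : ∀ x, h x * h x * (1 - z x) ≠ 0 → blkV i x ∉ Score := fun x hx =>
    hzS x fun hz => hx (by rw [hz, sub_self, mul_zero])
  have key := hall i hM hCG hm (Gl := Gl) (S := S) hG ha1 haS hh' hh'S hgap
  have e : (kOff (DP i) (mulOp h) (mulOp z) (mulOp h') * Gl) * mulOp h' =
      mulOp (fun x => h x * h x * (1 - z x)) * DP i * (mulOp h' * Gl * mulOp h') := by
    unfold kOff
    rw [mulOp_mul_mulOp_one_sub]
    simp only [mul_assoc]
  rw [e]
  refine hasMajorant_mono _ key fun y y' => le_of_eq ?_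
  congr 2
  ring

/-! ## §5  The displayed threshold: `θ₀ = Θ·C_G/(m·M) → 0`, hence `N²θ₀c₁ < 1` for `M ≥ M₁` -/

/-- **`θ₀ = O(M⁻¹)` MADE QUANTITATIVE**: for `N`, `c₁ ≥ 0`, `ε > 0` there is `M₁ > 0` with `N²·(Θ·C_G/(m·M))·c₁ < ε` for every `M ≥ M₁`
(`M₁ = N²ΘC_Gc₁/(mε) + 1`) — the located smallness of cell SMALLNESS S-B6.3 (`hsmall` of `…B6Prop26Gluing.prop26_2136_of_2133_2134` at `ε = 1`) as a largeness
condition on `M` alone after `d, L, δ_G, C_G, m, N, c₁`. [cite: Balaban1984PropagatorsII, (2.134)–(2.135) p.247 («O(M^{−1})»), bookkeeping] -/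
theorem theta0_lt {Θ CG m c₁ ε : ℝ} (N : ℕ) (hΘ : 0 ≤ Θ) (hCG : 0 ≤ CG) (hm : 0 < m) (hc₁ : 0 ≤ c₁) (hε : 0 < ε) :
    ∃ M₁ : ℝ, 0 < M₁ ∧ ∀ M : ℝ, M₁ ≤ M → (N : ℝ) ^ 2 * (Θ * CG / m * M⁻¹) * c₁ < ε := by
  obtain ⟨A, hA⟩ : ∃ A : ℝ, A = (N : ℝ) ^ 2 * Θ * CG / m * c₁ := ⟨_, rfl⟩
  have hAnn : 0 ≤ A := by rw [hA]; positivity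
  refine ⟨A / ε + 1, by positivity, fun M hM => ?_⟩
  have hMpos : 0 < M := lt_of_lt_of_le (by positivity) hM
  have hre : (N : ℝ) ^ 2 * (Θ * CG / m * M⁻¹) * c₁ = A / M := by rw [hA]; field_simp
  rw [hre, div_lt_iff₀ hMpos]
  have h1 : A < ε * (A / ε + 1) := by rw [mul_add, mul_div_cancel₀ _ hε.ne']; linarith
  nlinarith

/-- **(2.134) WITH ITS SMALLNESS, ABOVE ONE THRESHOLD**: for `δ_G > 0`, `C_G ≥ 0`, `m > 0`, an overlap number `N` and a walk constant `c₁ ≥ 0` there are `M₁`,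
`δ ∈ (0, δ_G]`, `Θ ≥ 0` such that every member with `L·M_h ≥ M₁` has BOTH `N²·θ₀·c₁ < 1` AND the majorant `θ₀·e^{−(δ/2)d}` of `K_{□,□′}G_{□′}h_{□′}` (□ ≠ □′,
hypotheses as in `ineq2134_kOff_kLevel`), `θ₀ = Θ·C_G/(m·M)` — the inputs `hsmall` and `h2134` (off-diagonal pairs) of `…B6Prop26Gluing.prop26_2136_of_2133_2134`
on the genuine `k`-level `∂P∂*`. [cite: Balaban1984PropagatorsII, (2.134)–(2.135) p.247, Prop. 2.6 p.247] -/
theorem ineq2134_kOff_kLevel_small (d ℓ : ℕ) (hℓ : 1 ≤ ℓ) {δG CG m c₁ : ℝ} (N : ℕ) (hδG : 0 < δG) (hCG : 0 ≤ CG) (hm : 0 < m) (hc₁ : 0 ≤ c₁) :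
    ∃ M₁ δ Θ : ℝ, 0 < M₁ ∧ 0 < δ ∧ δ ≤ δG ∧ 0 ≤ Θ ∧
      ∀ i : KIdx d ℓ, M₁ ≤ ((ℓ : ℝ) + 1) * i.Mh →
        (N : ℝ) ^ 2 * (Θ * CG / m * ((geoB i).M)⁻¹) * c₁ < 1 ∧
        ∀ {Gl : Module.End ℝ (XV i → ℝ)} {h z h' : XV i → ℝ} {S Score : Set (geoB i).Site},
          LocalMajorant (blkV i) Gl S (fun y'' y' => CG * (geoB i).len y'' ^ 2 * Real.exp (-(δG * (geoB i).dist y'' y'))) →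
          (∀ x, |h x| ≤ 1) → (∀ x, 0 ≤ z x) → (∀ x, z x ≤ 1) → (∀ x, z x ≠ 1 → blkV i x ∉ Score) →
          (∀ x, |h' x| ≤ 1) → (∀ x, h' x ≠ 0 → blkV i x ∈ S) →
          (∀ y y'', y ∉ Score → y'' ∈ S → m * (geoB i).M ≤ (geoB i).dist y y'') →
          HasMajorant (blkV i) ((kOff (DP i) (mulOp h) (mulOp z) (mulOp h') * Gl) * mulOp h')
            (fun y y' => Θ * CG / m * ((geoB i).M)⁻¹ * Real.exp (-(δ / 2 * (geoB i).dist y y'))) := by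
  obtain ⟨M₀, δ, Θ, hM₀, hδ, hδG', hΘ, hall⟩ := ineq2134_kOff_kLevel d ℓ hℓ hδG
  obtain ⟨M₂, hM₂, hsmall⟩ := theta0_lt (Θ := Θ) N hΘ hCG hm hc₁ zero_lt_one
  refine ⟨max M₀ M₂, δ, Θ, lt_max_of_lt_left hM₀, hδ, hδG', hΘ, fun i hM => ⟨?_, ?_⟩⟩
  · exact hsmall _ (by rw [geoB_M]; exact (le_max_right _ _).trans hM)
  · intro Gl h z h' S Score hG hh hz0 hz1 hzS hh' hh'S hgap
    exact hall i ((le_max_left _ _).trans hM) hCG hm hG hh hz0 hz1 hzS hh' hh'S hgap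

end Literature.MathematicalPhysics.QuantumFieldTheory.Balaban1983to89.B6Ineq2134ThetaKLevel

end
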